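import Summits.BirchSwinnertonDyer.BirchSwinnertonDyer.Theorems.SignedLowerHalvesSprungLowerDivisibilityAtThreeSlopeSeparationSegment
import HarnessLib

/-!
# Crux `SprungLowerDivisibilityAtThree` (item stmt-BirchSwinnertonDyer-19875), line `chromatic-common-zeros`:
# the GENERAL Newton-polygon coprimality criterion in `Λ = ℤ_p⟦T⟧` ("tie radii") — zeros of `G` lie on the
# circles where two terms `‖G_i‖|z|^i = ‖G_j‖|z|^j` tie for the maximum; if at every such circle of `G` the
# other function `F` has a UNIQUE dominant term, `F` and `G` share no zero and no height-one prime

Cell `bsd-ssimc` (host) / lead `cruxlead-stmt-BirchSwinnertonDyer-19875`; width seat `-w3` (gen 3);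
`--supports` 19875 `--as helper`; THEOREMS ONLY (pure `p`-adic algebra, general `p`; no definition, no named
fact, nothing about any curve asserted); closes no item; BSD / K1 / leaf X8 are NOT proved by anything here.

Sequel of `…SlopeSeparationSegment.lean` (p625449: the ONE-segment case). The x8 lit seat's census (DOSSIER
v2.30 T54 (i2)) lists 20 X8 cells whose two chromatic `3`-adic `L`-functions have NUMERICALLY disjoint but
MULTI-segment Newton polygons and notes «a multi-segment Newton-polygon door, i.e. [Ko84] §IV.4 Corollary in
full, is not in the tree». This file supplies it in the form that needs no convex-hull bookkeeping:

* §1 `norm_tsum_eq_of_uniqueMax` / `not_hasSum_zero_of_uniqueMax` — **unique dominant term ⟹ no zero**: for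
  `G ∈ Λ` with `μ(G) = 0`, `0 < |z| = s < 1`, if some index `k₀ ≤ λ(G)` has `‖G_{k₀}‖ s^{k₀} > ‖G_k‖ s^k` for
  every other `k ≤ λ(G)`, then `|G(z)| = ‖G_{k₀}‖ s^{k₀} ≠ 0` (the tail `k > λ` is `≤ s^{λ+1} < s^λ`).
* §2 `exists_tie_of_hasSum_zero` — **a zero forces a tie**: if `G(z) = 0`, `0 < s = |z| < 1`, there are
  `i < j ≤ λ(G)` with `‖G_i‖ s^i = ‖G_j‖ s^j ≥ ‖G_k‖ s^k` for all `k ≤ λ(G)`, `G_i ≠ 0`, and `‖G_i‖ < ‖G_j‖`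
  (so `s^{j−i} = ‖G_i‖/‖G_j‖`: the TIE RADIUS of the pair `(i, j)`).
* §3 **`not_common_zero_of_tieSeparated` / `not_mem_and_mem_of_tieSeparated`** — `F, G` with `μ = 0`,
  `F_0 ≠ 0`, and the TIE-SEPARATION CERTIFICATE: for every pair `i < j ≤ λ(G)` with `G_i ≠ 0`,
  `‖G_i‖ < ‖G_j‖`, some `k₀ ≤ λ(F)` satisfies, for all `k ≤ λ(F)`, `k ≠ k₀`,
  `‖F_k‖^{j−i}·‖G_i‖^k·‖G_j‖^{k₀} < ‖F_{k₀}‖^{j−i}·‖G_i‖^{k₀}·‖G_j‖^k` (= «at the tie radius of `(i,j)` the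
  term `k₀` of `F` strictly dominates», cleared of roots) ⟹ no common zero in the open disc, hence NO common
  height-one prime of `Λ`; `…_X_mul_…` the `T`-shifted form. The certificate is a finite list of
  inequalities between monomials in the coefficient absolute values — decidable from the valuations the x8
  engines compute, for ANY Newton polygons.

References (ATTRIBUTION): [Koblitz1984] N. Koblitz, GTM 58, Ch. IV §3–§4 (Newton polygon of a power series and
the absolute values of its zeros); [Washington1997] §7.1–7.2, Thm. 7.3, §13.2; [Lang1990] Ch. 5 §2. Tree:
`…SlopeSeparation{,Segment}.lean`, `Rank1Residual/Iwasawa/LambdaInvariant*`, `Literature/…/PAdicPowerSeriesZeros.lean`.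
-/

set_option autoImplicit false
-- justification: the mandated namespace `Summit.BirchSwinnertonDyer.BirchSwinnertonDyer.Theorems`
-- (single-conjunct summit, Sub = Summit) repeats a segment by design (D-0017).
set_option linter.dupNamespace false

noncomputable section

open scoped Classical

open Polynomial Literature.NumberTheory.EllipticCurves
  Summit.BirchSwinnertonDyer.Rank1Residual.X1.MuLambda
  Summit.BirchSwinnertonDyer.Rank1Residual.Iwasawa

namespace Summit.BirchSwinnertonDyer.BirchSwinnertonDyer.Theorems.ChromaticSlopeSeparation

variable {p : ℕ} [hp : Fact p.Prime]

/-! ## §1. A unique dominant term excludes a zero -/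

section UniqueMax

/-- **Unique dominant term ⟹ `|G(z)| = ‖G_{k₀}‖ |z|^{k₀}`.** For `G ∈ Λ ∖ {0}` with `μ(G) = 0`, `0 < |z| < 1`,
and an index `k₀` whose term strictly dominates every other term of index `≤ λ(G)`: the whole
evaluation series is dominated by that term (the terms of index `> λ(G)` are `≤ |z|^{λ(G)+1} < |z|^{λ(G)}`,
the term of the unit coefficient). [cite: Koblitz1984, Ch. IV §4 (Newton polygon of a power series)] -/
theorem norm_tsum_eq_of_uniqueMax {G : IwasawaAlgebra p} (hG0 : G ≠ 0) (hμ : mu G = 0) {z : ℂ_[p]}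
    (hz : ‖z‖ < 1) (hz0 : 0 < ‖z‖) {k₀ : ℕ}
    (hdom : ∀ k, k ≤ lam G → k ≠ k₀ → ‖PowerSeries.coeff k G‖ * ‖z‖ ^ k <
      ‖PowerSeries.coeff k₀ G‖ * ‖z‖ ^ k₀) :
    ‖∑' k, ((algebraMap ℚ_[p] ℂ_[p]).comp (algebraMap ℤ_[p] ℚ_[p])) (PowerSeries.coeff k G) * z ^ k‖ =
      ‖PowerSeries.coeff k₀ G‖ * ‖z‖ ^ k₀ := by
  set ιZ : ℤ_[p] →+* ℂ_[p] := (algebraMap ℚ_[p] ℂ_[p]).comp (algebraMap ℤ_[p] ℚ_[p]) with hιZ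
  set s : ℝ := ‖z‖ with hs
  have hs0 : 0 ≤ s := norm_nonneg _
  have hterm : ∀ k, ‖ιZ (PowerSeries.coeff k G) * z ^ k‖ = ‖PowerSeries.coeff k G‖ * s ^ k := by
    intro k; rw [norm_mul, norm_pow, hιZ, norm_algebraMap_comp_apply]
  -- the top term `k = λ` has norm `s^λ`, and is `≤` the dominant one
  have htop : ‖PowerSeries.coeff (lam G) G‖ * s ^ lam G = s ^ lam G := by
    rw [← norm_algebraMap_comp_apply, norm_coeff_lam_eq_one hG0 hμ, one_mul]
  have hM : s ^ lam G ≤ ‖PowerSeries.coeff k₀ G‖ * s ^ k₀ := by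
    by_cases h : lam G = k₀
    · rw [← h, htop]
    · rw [← htop]; exact (hdom (lam G) le_rfl h).le
  -- uniform bound for the other terms: finite max over `k ≤ λ`, tail `s^{λ+1}`
  obtain ⟨δ₁, hδ₁lt, hδ₁0, hδ₁⟩ : ∃ δ₁ : ℝ, δ₁ < ‖PowerSeries.coeff k₀ G‖ * s ^ k₀ ∧ 0 ≤ δ₁ ∧
      ∀ k, k ≤ lam G → k ≠ k₀ → ‖ιZ (PowerSeries.coeff k G) * z ^ k‖ ≤ δ₁ := by
    by_cases hne : ((Finset.range (lam G + 1)).erase k₀).Nonempty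
    · obtain ⟨k₁, hk₁, hmax⟩ := Finset.exists_max_image ((Finset.range (lam G + 1)).erase k₀)
        (fun k ↦ ‖ιZ (PowerSeries.coeff k G) * z ^ k‖) hne
      rw [Finset.mem_erase, Finset.mem_range] at hk₁
      refine ⟨_, ?_, norm_nonneg _, fun k hk hkk ↦ hmax k (Finset.mem_erase.mpr
        ⟨hkk, Finset.mem_range.mpr (Nat.lt_succ_of_le hk)⟩)⟩
      rw [hterm]; exact hdom k₁ (Nat.le_of_lt_succ hk₁.2) hk₁.1
    · refine ⟨0, lt_of_lt_of_le (pow_pos hz0 _) hM, le_rfl, fun k hk hkk ↦ ?_⟩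
      exact absurd ⟨k, Finset.mem_erase.mpr ⟨hkk, Finset.mem_range.mpr (Nat.lt_succ_of_le hk)⟩⟩ hne
  set δ : ℝ := max δ₁ (s ^ (lam G + 1)) with hδ
  have hδlt : δ < ‖PowerSeries.coeff k₀ G‖ * s ^ k₀ := by
    refine max_lt hδ₁lt (lt_of_lt_of_le ?_ hM)
    calc s ^ (lam G + 1) = s ^ lam G * s := pow_succ _ _
      _ < s ^ lam G * 1 := mul_lt_mul_of_pos_left hz (pow_pos hz0 _)
      _ = s ^ lam G := mul_one _
  have hδ0 : 0 ≤ δ := le_trans hδ₁0 (le_max_left _ _)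
  rw [← hterm k₀]
  refine norm_tsum_eq_of_dominant G hz k₀ hδ0 (by rw [hterm]; exact hδlt) fun k hk ↦ ?_
  by_cases hkl : k ≤ lam G
  · exact le_trans (hδ₁ k hkl hk) (le_max_left _ _)
  · rw [not_le] at hkl
    rw [hterm]
    calc ‖PowerSeries.coeff k G‖ * s ^ k ≤ 1 * s ^ (lam G + 1) :=
          mul_le_mul (PadicInt.norm_le_one _) (pow_le_pow_of_le_one hs0 hz.le hkl)
            (pow_nonneg hs0 _) zero_le_one
      _ = s ^ (lam G + 1) := one_mul _
      _ ≤ δ := le_max_right _ _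

/-- **Unique dominant term ⟹ no zero on that circle.** [cite: Koblitz1984, Ch. IV §4 (Newton polygon of a power series)] -/
theorem not_hasSum_zero_of_uniqueMax {G : IwasawaAlgebra p} (hG0 : G ≠ 0) (hμ : mu G = 0) {z : ℂ_[p]}
    (hz : ‖z‖ < 1) (hz0 : 0 < ‖z‖) {k₀ : ℕ}
    (hdom : ∀ k, k ≤ lam G → k ≠ k₀ → ‖PowerSeries.coeff k G‖ * ‖z‖ ^ k <
      ‖PowerSeries.coeff k₀ G‖ * ‖z‖ ^ k₀) :
    ¬ HasSum (fun k ↦ ((algebraMap ℚ_[p] ℂ_[p]).comp (algebraMap ℤ_[p] ℚ_[p]))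
      (PowerSeries.coeff k G) * z ^ k) 0 := by
  intro hsum
  have h := norm_tsum_eq_of_uniqueMax hG0 hμ hz hz0 hdom
  rw [hsum.tsum_eq, norm_zero] at h
  -- the dominant term is positive: it dominates the top term `s^λ > 0`
  have htop : 0 < ‖PowerSeries.coeff (lam G) G‖ * ‖z‖ ^ lam G := by
    rw [← norm_algebraMap_comp_apply, norm_coeff_lam_eq_one hG0 hμ, one_mul]; exact pow_pos hz0 _
  have hpos : 0 < ‖PowerSeries.coeff k₀ G‖ * ‖z‖ ^ k₀ := by
    by_cases hk : lam G = k₀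
    · rw [← hk]; exact htop
    · exact lt_trans htop (hdom (lam G) le_rfl hk)
  exact absurd h hpos.ne

end UniqueMax

/-! ## §2. A zero forces a tie between two terms for the maximum -/

section Tie

/-- **A zero forces a tie.** For `G ∈ Λ ∖ {0}` with `μ(G) = 0` and a zero `z`, `0 < |z| = s < 1`: there are
indices `i < j ≤ λ(G)` whose terms TIE for the maximum — `‖G_i‖ s^i = ‖G_j‖ s^j ≥ ‖G_k‖ s^k` for every
`k ≤ λ(G)` — with `G_i ≠ 0` and `‖G_i‖ < ‖G_j‖` (so `s^{j−i} = ‖G_i‖/‖G_j‖`: `s` is the tie radius of `(i, j)`).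
[cite: Koblitz1984, Ch. IV §4 (Newton polygon of a power series)] -/
theorem exists_tie_of_hasSum_zero {G : IwasawaAlgebra p} (hG0 : G ≠ 0) (hμ : mu G = 0) {z : ℂ_[p]}
    (hz : ‖z‖ < 1) (hz0 : 0 < ‖z‖)
    (hsum : HasSum (fun k ↦ ((algebraMap ℚ_[p] ℂ_[p]).comp (algebraMap ℤ_[p] ℚ_[p]))
      (PowerSeries.coeff k G) * z ^ k) 0) :
    ∃ i j : ℕ, i < j ∧ j ≤ lam G ∧ PowerSeries.coeff i G ≠ 0 ∧
      ‖PowerSeries.coeff i G‖ < ‖PowerSeries.coeff j G‖ ∧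
      ‖PowerSeries.coeff i G‖ * ‖z‖ ^ i = ‖PowerSeries.coeff j G‖ * ‖z‖ ^ j ∧
      ∀ k, k ≤ lam G → ‖PowerSeries.coeff k G‖ * ‖z‖ ^ k ≤ ‖PowerSeries.coeff j G‖ * ‖z‖ ^ j := by
  set s : ℝ := ‖z‖ with hs
  set t : ℕ → ℝ := fun k ↦ ‖PowerSeries.coeff k G‖ * s ^ k with ht
  have hne : (Finset.range (lam G + 1)).Nonempty := ⟨0, Finset.mem_range.mpr (Nat.succ_pos _)⟩
  -- a maximiser `j₁` of `t` on `[0, λ]`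
  obtain ⟨j₁, hj₁, hmax₁⟩ := Finset.exists_max_image (Finset.range (lam G + 1)) t hne
  have hj₁le : j₁ ≤ lam G := Nat.le_of_lt_succ (Finset.mem_range.mp hj₁)
  have hmax : ∀ k, k ≤ lam G → t k ≤ t j₁ :=
    fun k hk ↦ hmax₁ k (Finset.mem_range.mpr (Nat.lt_succ_of_le hk))
  -- the maximum is not unique (else no zero): a second maximiser `j₂ ≠ j₁`
  have hnotuniq : ∃ j₂, j₂ ≤ lam G ∧ j₂ ≠ j₁ ∧ t j₂ = t j₁ := by
    by_contra hcon
    push Not at hcon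
    refine not_hasSum_zero_of_uniqueMax hG0 hμ hz hz0 (k₀ := j₁) (fun k hk hkj ↦ ?_) hsum
    exact lt_of_le_of_ne (hmax k hk) (hcon k hk hkj)
  obtain ⟨j₂, hj₂le, hj₂ne, hj₂eq⟩ := hnotuniq
  -- order the two maximisers
  obtain ⟨i, j, hij, hjle, hile, hti, htj⟩ : ∃ i j : ℕ, i < j ∧ j ≤ lam G ∧ i ≤ lam G ∧
      t i = t j₁ ∧ t j = t j₁ := by
    rcases lt_or_gt_of_ne hj₂ne with h | h
    · exact ⟨j₂, j₁, h, hj₁le, hj₂le, hj₂eq, rfl⟩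
    · exact ⟨j₁, j₂, h, hj₂le, hj₁le, rfl, hj₂eq⟩
  -- the common value is positive (it dominates the top term `s^λ > 0`)
  have htop : 0 < t (lam G) := by
    change 0 < ‖PowerSeries.coeff (lam G) G‖ * s ^ lam G
    rw [← norm_algebraMap_comp_apply, norm_coeff_lam_eq_one hG0 hμ, one_mul]; exact pow_pos hz0 _
  have hpos : 0 < t j₁ := lt_of_lt_of_le htop (hmax _ le_rfl)
  have hGi : PowerSeries.coeff i G ≠ 0 := by
    intro h0
    have : t i = 0 := by change ‖PowerSeries.coeff i G‖ * s ^ i = 0; rw [h0, norm_zero, zero_mul]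
    rw [this] at hti
    exact hpos.ne hti
  have htij : ‖PowerSeries.coeff i G‖ * s ^ i = ‖PowerSeries.coeff j G‖ * s ^ j := by
    change t i = t j; rw [hti, htj]
  -- `‖G_i‖ < ‖G_j‖`: `‖G_i‖ s^i = ‖G_j‖ s^j = ‖G_j‖ s^i · s^{j−i}` with `s^{j−i} < 1`
  have hlt : ‖PowerSeries.coeff i G‖ < ‖PowerSeries.coeff j G‖ := by
    have hsi : 0 < s ^ i := pow_pos hz0 _
    have h1 : s ^ j < s ^ i := pow_lt_pow_right_of_lt_one₀ hz0 hz hij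
    have hGj : 0 < ‖PowerSeries.coeff j G‖ := by
      by_contra hle
      rw [not_lt] at hle
      have h0 : ‖PowerSeries.coeff j G‖ = 0 := le_antisymm hle (norm_nonneg _)
      rw [h0, zero_mul] at htij
      exact hGi (norm_eq_zero.mp (by
        rcases mul_eq_zero.mp htij with h | h
        · exact h
        · exact absurd h hsi.ne'))
    by_contra hge
    rw [not_lt] at hge
    have : ‖PowerSeries.coeff j G‖ * s ^ j < ‖PowerSeries.coeff i G‖ * s ^ i :=
      calc ‖PowerSeries.coeff j G‖ * s ^ j < ‖PowerSeries.coeff j G‖ * s ^ i :=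
            mul_lt_mul_of_pos_left h1 hGj
        _ ≤ ‖PowerSeries.coeff i G‖ * s ^ i := mul_le_mul_of_nonneg_right hge hsi.le
    rw [htij] at this
    exact lt_irrefl _ this
  refine ⟨i, j, hij, hjle, hGi, hlt, htij, fun k hk ↦ ?_⟩
  change t k ≤ t j
  rw [htj]; exact hmax k hk

end Tie

/-! ## §3. Two functions: the tie-separation certificate -/

section TieSeparated

/-- **TIE SEPARATION ⟹ no common zero.** `F, G ∈ Λ ∖ {0}` with `μ(F) = μ(G) = 0`, `F(0) ≠ 0`, and the
certificate: for every pair `i < j ≤ λ(G)` with `G_i ≠ 0` and `‖G_i‖ < ‖G_j‖` there is `k₀ ≤ λ(F)` such that for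
all `k ≤ λ(F)`, `k ≠ k₀`: `‖F_k‖^{j−i}·‖G_i‖^k·‖G_j‖^{k₀} < ‖F_{k₀}‖^{j−i}·‖G_i‖^{k₀}·‖G_j‖^k`. Then no `z` in
the open unit disc of `ℂ_p` is a common zero: at `s = |z|` a zero of `G` forces a tie `(i, j)` with
`s^{j−i} = ‖G_i‖/‖G_j‖`, and the certificate (after extracting `(j−i)`-th roots) says the term `k₀` of `F`
strictly dominates at `s`, so `F(z) ≠ 0`. [cite: Koblitz1984, Ch. IV §4 (Newton polygon of a power series)]
[cite: Washington1997, §7.1–7.2 and Thm. 7.3] -/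
theorem not_common_zero_of_tieSeparated {F G : IwasawaAlgebra p} (hF0 : F ≠ 0) (hG0 : G ≠ 0)
    (hμF : mu F = 0) (hμG : mu G = 0) (hFc : PowerSeries.constantCoeff F ≠ 0)
    (hcert : ∀ i j : ℕ, i < j → j ≤ lam G → PowerSeries.coeff i G ≠ 0 →
      ‖PowerSeries.coeff i G‖ < ‖PowerSeries.coeff j G‖ →
      ∃ k₀, k₀ ≤ lam F ∧ ∀ k, k ≤ lam F → k ≠ k₀ →
        ‖PowerSeries.coeff k F‖ ^ (j - i) * ‖PowerSeries.coeff i G‖ ^ k * ‖PowerSeries.coeff j G‖ ^ k₀ <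
          ‖PowerSeries.coeff k₀ F‖ ^ (j - i) * ‖PowerSeries.coeff i G‖ ^ k₀ * ‖PowerSeries.coeff j G‖ ^ k)
    {z : ℂ_[p]} (hz : ‖z‖ < 1)
    (hFz : HasSum (fun k ↦ ((algebraMap ℚ_[p] ℂ_[p]).comp (algebraMap ℤ_[p] ℚ_[p]))
      (PowerSeries.coeff k F) * z ^ k) 0)
    (hGz : HasSum (fun k ↦ ((algebraMap ℚ_[p] ℂ_[p]).comp (algebraMap ℤ_[p] ℚ_[p]))
      (PowerSeries.coeff k G) * z ^ k) 0) : False := by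
  set ιZ : ℤ_[p] →+* ℂ_[p] := (algebraMap ℚ_[p] ℂ_[p]).comp (algebraMap ℤ_[p] ℚ_[p]) with hιZ
  set s : ℝ := ‖z‖ with hs
  have hs0 : 0 ≤ s := norm_nonneg _
  -- `z ≠ 0`: `F(0) = F_0 ≠ 0`
  have hz0 : 0 < s := by
    by_contra hle
    rw [not_lt] at hle
    have hz00 : z = 0 := norm_eq_zero.mp (le_antisymm hle hs0)
    have hF00 : HasSum (fun k ↦ ιZ (PowerSeries.coeff k F) * z ^ k) (ιZ (PowerSeries.coeff 0 F)) := by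
      have h := hasSum_single (f := fun k ↦ ιZ (PowerSeries.coeff k F) * z ^ k) 0 (fun k hk ↦ by
        rw [hz00, zero_pow hk, mul_zero])
      simpa [hz00] using h
    have heq := hFz.unique hF00
    rw [PowerSeries.coeff_zero_eq_constantCoeff_apply] at heq
    exact hFc (injective_algebraMap_comp (a₁ := PowerSeries.constantCoeff F) (a₂ := 0)
      (by rw [map_zero]; exact heq.symm))
  -- a zero of `G` forces a tie `(i, j)`
  obtain ⟨i, j, hij, hjle, hGi, hGij, htie, -⟩ := exists_tie_of_hasSum_zero hG0 hμG hz hz0 hGz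
  obtain ⟨k₀, -, hdom⟩ := hcert i j hij hjle hGi hGij
  -- translate the certificate at the tie radius: `s^{j−i} = ‖G_i‖/‖G_j‖`
  have hGipos : 0 < ‖PowerSeries.coeff i G‖ := norm_pos_iff.mpr hGi
  have hGjpos : 0 < ‖PowerSeries.coeff j G‖ := lt_trans hGipos hGij
  have hsji : s ^ (j - i) * ‖PowerSeries.coeff j G‖ = ‖PowerSeries.coeff i G‖ := by
    have hsi : s ^ i ≠ 0 := (pow_pos hz0 _).ne'
    have hj : s ^ j = s ^ (j - i) * s ^ i := by rw [← pow_add, Nat.sub_add_cancel hij.le]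
    have h : (s ^ (j - i) * ‖PowerSeries.coeff j G‖) * s ^ i = ‖PowerSeries.coeff i G‖ * s ^ i := by
      rw [htie, hj]; ring
    exact mul_right_cancel₀ hsi h
  have hdom' : ∀ k, k ≤ lam F → k ≠ k₀ →
      ‖PowerSeries.coeff k F‖ * s ^ k < ‖PowerSeries.coeff k₀ F‖ * s ^ k₀ := by
    intro k hk hkk
    have h := hdom k hk hkk
    -- raise both sides of the goal to the power `j − i` and multiply by `‖G_j‖^{k + k₀}`
    have hji : 0 < j - i := Nat.sub_pos_of_lt hij
    refine lt_of_pow_lt_pow_left₀ (j - i) (mul_nonneg (norm_nonneg _) (pow_nonneg hs0 _)) ?_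
    have hGjk : 0 < ‖PowerSeries.coeff j G‖ ^ (k + k₀) := pow_pos hGjpos _
    refine lt_of_mul_lt_mul_right ?_ hGjk.le
    have e1 : (‖PowerSeries.coeff k F‖ * s ^ k) ^ (j - i) * ‖PowerSeries.coeff j G‖ ^ (k + k₀) =
        ‖PowerSeries.coeff k F‖ ^ (j - i) * ‖PowerSeries.coeff i G‖ ^ k * ‖PowerSeries.coeff j G‖ ^ k₀ := by
      rw [← hsji]; ring
    have e2 : (‖PowerSeries.coeff k₀ F‖ * s ^ k₀) ^ (j - i) * ‖PowerSeries.coeff j G‖ ^ (k + k₀) =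
        ‖PowerSeries.coeff k₀ F‖ ^ (j - i) * ‖PowerSeries.coeff i G‖ ^ k₀ * ‖PowerSeries.coeff j G‖ ^ k := by
      rw [← hsji]; ring
    rw [e1, e2]
    exact h
  exact not_hasSum_zero_of_uniqueMax hF0 hμF hz hz0 hdom' hFz

/-- **TIE SEPARATION ⟹ no common height-one prime of `Λ`** (`(p)` by `μ(F) = 0`; `(f)`, `f` distinguished
irreducible, by its common zero in `ℂ_p`). [cite: Washington1997, §7.1–7.2, Thm. 7.3 and §13.2]
[cite: Koblitz1984, Ch. IV §4 (Newton polygon of a power series)] -/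
theorem not_mem_and_mem_of_tieSeparated {F G : IwasawaAlgebra p} (hF0 : F ≠ 0) (hG0 : G ≠ 0)
    (hμF : mu F = 0) (hμG : mu G = 0) (hFc : PowerSeries.constantCoeff F ≠ 0)
    (hcert : ∀ i j : ℕ, i < j → j ≤ lam G → PowerSeries.coeff i G ≠ 0 →
      ‖PowerSeries.coeff i G‖ < ‖PowerSeries.coeff j G‖ →
      ∃ k₀, k₀ ≤ lam F ∧ ∀ k, k ≤ lam F → k ≠ k₀ →
        ‖PowerSeries.coeff k F‖ ^ (j - i) * ‖PowerSeries.coeff i G‖ ^ k * ‖PowerSeries.coeff j G‖ ^ k₀ <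
          ‖PowerSeries.coeff k₀ F‖ ^ (j - i) * ‖PowerSeries.coeff i G‖ ^ k₀ * ‖PowerSeries.coeff j G‖ ^ k)
    (𝔭 : PrimeSpectrum (IwasawaAlgebra p)) (h𝔭 : 𝔭.asIdeal.height = 1) :
    ¬ (F ∈ 𝔭.asIdeal ∧ G ∈ 𝔭.asIdeal) := by
  rintro ⟨hF𝔭, hG𝔭⟩
  rcases IwasawaAlgebra.eq_span_of_height_eq_one p 𝔭.asIdeal h𝔭 with hp𝔭 | ⟨f, hf, hirr, hf𝔭⟩
  · rw [hp𝔭, Ideal.mem_span_singleton] at hF𝔭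
    have h1 : 1 ≤ mu F := le_mu_of_C_pow_dvd hF0 (by rwa [pow_one])
    omega
  · obtain ⟨z, hz, hzero⟩ := exists_common_zero_of_span_distinguished hf hirr
    rw [hf𝔭] at hF𝔭 hG𝔭
    exact not_common_zero_of_tieSeparated hF0 hG0 hμF hμG hFc hcert hz (hzero F hF𝔭) (hzero G hG𝔭)

/-- **The `T`-shifted form** (off `(T)`). [cite: Washington1997, §7.1–7.2, Thm. 7.3 and §13.2] -/
theorem not_mem_and_mem_of_X_mul_of_tieSeparated {F G F₁ G₁ : IwasawaAlgebra p}
    (hFF : F = PowerSeries.X * F₁) (hGG : G = PowerSeries.X * G₁) (hF0 : F₁ ≠ 0) (hG0 : G₁ ≠ 0)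
    (hμF : mu F₁ = 0) (hμG : mu G₁ = 0) (hFc : PowerSeries.constantCoeff F₁ ≠ 0)
    (hcert : ∀ i j : ℕ, i < j → j ≤ lam G₁ → PowerSeries.coeff i G₁ ≠ 0 →
      ‖PowerSeries.coeff i G₁‖ < ‖PowerSeries.coeff j G₁‖ →
      ∃ k₀, k₀ ≤ lam F₁ ∧ ∀ k, k ≤ lam F₁ → k ≠ k₀ →
        ‖PowerSeries.coeff k F₁‖ ^ (j - i) * ‖PowerSeries.coeff i G₁‖ ^ k * ‖PowerSeries.coeff j G₁‖ ^ k₀ <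
          ‖PowerSeries.coeff k₀ F₁‖ ^ (j - i) * ‖PowerSeries.coeff i G₁‖ ^ k₀ * ‖PowerSeries.coeff j G₁‖ ^ k)
    (𝔭 : PrimeSpectrum (IwasawaAlgebra p)) (h𝔭 : 𝔭.asIdeal.height = 1)
    (hT : (PowerSeries.X : IwasawaAlgebra p) ∉ 𝔭.asIdeal) :
    ¬ (F ∈ 𝔭.asIdeal ∧ G ∈ 𝔭.asIdeal) := by
  rintro ⟨hF𝔭, hG𝔭⟩
  rw [hFF] at hF𝔭
  rw [hGG] at hG𝔭
  exact not_mem_and_mem_of_tieSeparated hF0 hG0 hμF hμG hFc hcert 𝔭 h𝔭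
    ⟨(𝔭.isPrime.mem_or_mem hF𝔭).resolve_left hT, (𝔭.isPrime.mem_or_mem hG𝔭).resolve_left hT⟩

end TieSeparated

end Summit.BirchSwinnertonDyer.BirchSwinnertonDyer.Theorems.ChromaticSlopeSeparation

end
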